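import Literature.NumberTheory.Transcendental.NesterenkoEliminationProofs
import Literature.NumberTheory.Transcendental.NesterenkoEliminationLocalization
import Literature.NumberTheory.Transcendental.NesterenkoEliminationPrimeForm
import Literature.NumberTheory.Transcendental.NesterenkoEliminationPrimaryForm
import Literature.NumberTheory.Transcendental.NesterenkoChowFormDistinct
import Literature.NumberTheory.Transcendental.NesterenkoSymbolicPowers
import Literature.NumberTheory.Transcendental.PhilipponCriterionRank
import HarnessLib

/-!
# LNM 1752 Ch. 3 Proposition 4.4 (associated forms of unmixed ideals) — the discharge `…prop_4_4_holds`

Topic `Literature/NumberTheory/Transcendental`. This file proves the named fact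
`NesterenkoPhilippon2001_ch3_prop_4_4` of `NesterenkoEliminationFacts.lean` (Yu. V. Nesterenko in
Nesterenko–Philippon (eds.), LNM 1752 (2001), Ch. 3 Prop. 4.4, p. 38; the book's proof line is
"See [Nes2] and Chapter 6", [Nes2] = Nesterenko, Izv. AN SSSR Ser. Mat. 41 (1977) §1), by feeding the
reduction `NesterenkoPhilippon2001_ch3_prop_4_4_of` (`NesterenkoEliminationProofs.lean`, where the
`S_r`-symmetry clause is proved outright) its four classical inputs, all of which are now theorems
of the tree:

* `h1` — Philippon, Publ. Math. IHÉS 64 (1986), Prop. 1.3 (ii), (iv) (`𝔭̄(r)` is prime when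
  `(x̲) ⊄ 𝔭`; `Ī(r) = ⋂ Ī_j(r)` along a primary decomposition): `isPrime_elimIdeal`,
  `elimIdeal_eq_iInf_of_isMinimalPrimaryDecomposition` (`NesterenkoEliminationLocalization.lean`);
* `h2` — Philippon 1986 Prop. 1.5 (ii)–(iii) = the prime case of Prop. 4.4 (`𝔭̄(r)` is a non-zero
  principal ideal): `isPrincipal_elimIdeal_of_isPrime`, `elimIdeal_ne_bot`
  (`NesterenkoEliminationPrimeForm.lean`);
* `h3` — the exponent law for a primary component, `Q̄(r) = (Fᵏ)`, `k` the exponent of `Q`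
  ([Nes2] §1; Philippon 1986, Remarque after Prop. 1.3): `elimIdeal_eq_span_pow_of_isPrimary`
  (`NesterenkoEliminationPrimaryForm.lean`), which needs the component `Q` to be HOMOGENEOUS — this
  is supplied here (`isHomogeneous_of_mem_isMinimalPrimaryDecomposition`): the primary components of
  a homogeneous ideal all of whose associated primes have the same dimension are isolated components,
  `Q = {a : s a ∈ I for some s ∉ √Q}` (`exists_notMem_radical_mul_mem`), hence equal to their
  homogeneous cores, which are primary (`isPrimary_homogeneousCore`, Bruns–Herzog Lemma 1.5.6) and
  contain `I` (Zariski–Samuel II, Ch. VII §2, Thm. 9, Cor.);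
* `h4` — "no two distinct varieties have the same Cayley form" (Hodge–Pedoe II, Ch. X §7):
  `eq_of_elimIdeal_eq` (`NesterenkoChowFormDistinct.lean`).

Proofs only: no definitions, no named facts.

## References

* [NesterenkoPhilippon2001] Yu. V. Nesterenko, P. Philippon (eds.), *Introduction to Algebraic
  Independence Theory*, LNM 1752, Springer 2001, Ch. 3 §4, Prop. 4.4 (p. 38); Ch. 10 p. 175.
* [Nesterenko1977] Yu. V. Nesterenko, *Estimates for the orders of zeros of functions of a certain
  class and applications in the theory of transcendental numbers*, Izv. Akad. Nauk SSSR Ser. Mat. 41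
  (1977) 253–284 (= Math. USSR-Izv. 11 (1977) 239–270), §1.
* [Philippon1986Criteres] P. Philippon, *Critères pour l'indépendance algébrique*, Publ. Math. IHÉS
  64 (1986) 5–52, §1 (Lemme 1.2, Prop. 1.3, 1.5).
* [HodgePedoe1994] W. V. D. Hodge, D. Pedoe, *Methods of Algebraic Geometry* II, Ch. X §§6–7.
* O. Zariski, P. Samuel, *Commutative Algebra* II (1960), Ch. VII §2, Thm. 9 and Corollary;
  W. Bruns, J. Herzog, *Cohen–Macaulay rings* (1998), Lemma 1.5.6.
-/

noncomputable section

open MvPolynomial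

attribute [local instance] MvPolynomial.gradedAlgebra

namespace Literature.NumberTheory.Transcendental

namespace Nesterenko

variable {m : ℕ}

/-! ### Primary components of a homogeneous unmixed ideal are isolated, hence homogeneous -/

/-- In a minimal primary decomposition of an ideal all of whose associated primes have the same
(finite) dimension, no radical of a component lies inside the radical of another component: all
components are isolated. [folklore] -/
theorem not_radical_le_radical_of_isUnmixedOfRank {I : Ideal (Rx m)} {r : ℕ}
    (hunm : IsUnmixedOfRank I r) {t : Finset (Ideal (Rx m))}
    (ht : Submodule.IsMinimalPrimaryDecomposition I t) {Q Q' : Ideal (Rx m)} (hQ : Q ∈ t)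
    (hQ' : Q' ∈ t) (hne : Q' ≠ Q) : ¬ Q'.radical ≤ Q.radical := by
  intro hle
  have hrad : ∀ P ∈ t, P.radical ∈ I.associatedPrimes := fun P hP => by
    have h := ht.mem_associatedPrimes hP
    rwa [Submodule.colon_univ] at h
  have heq : Q'.radical = Q.radical :=
    PhilipponMain.eq_of_le_of_ringKrullDim_quotient_eq (Ideal.isPrime_radical (ht.primary hQ')) hle
      (hunm.2 _ (hrad Q' hQ')) (hunm.2 _ (hrad Q hQ))
  refine ht.distinct (Finset.mem_coe.mpr hQ') (Finset.mem_coe.mpr hQ) hne ?_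
  show (Submodule.colon Q' Set.univ).radical = (Submodule.colon Q Set.univ).radical
  rw [Submodule.colon_univ, Submodule.colon_univ]
  exact heq

/-- **Isolated components** (second uniqueness theorem, elementary half): for a component `Q` of a
minimal primary decomposition of an unmixed ideal `I` and `a ∈ Q` there is `s ∉ √Q` with
`s a ∈ I` — take for `s` a product of suitable powers of elements of `√Q' ∖ √Q`, `Q' ≠ Q`.
[folklore] -/
theorem exists_notMem_radical_mul_mem {I : Ideal (Rx m)} {r : ℕ} (hunm : IsUnmixedOfRank I r)
    {t : Finset (Ideal (Rx m))} (ht : Submodule.IsMinimalPrimaryDecomposition I t)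
    {Q : Ideal (Rx m)} (hQ : Q ∈ t) {a : Rx m} (ha : a ∈ Q) :
    ∃ s ∉ Q.radical, s * a ∈ I := by
  classical
  haveI hP : Q.radical.IsPrime := Ideal.isPrime_radical (ht.primary hQ)
  have hex : ∀ Q' ∈ t.erase Q, ∃ s ∉ Q.radical, s ∈ Q' := by
    intro Q' hQ'
    obtain ⟨hne, hQ't⟩ := Finset.mem_erase.mp hQ'
    obtain ⟨x, hx, hxnot⟩ :=
      Set.not_subset.mp (not_radical_le_radical_of_isUnmixedOfRank hunm ht hQ hQ't hne)
    obtain ⟨n, hn⟩ := hx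
    exact ⟨x ^ n, fun h => hxnot (hP.mem_of_pow_mem n h), hn⟩
  choose! s hs using hex
  refine ⟨∏ Q' ∈ t.erase Q, s Q', ?_, ?_⟩
  · intro hmem
    obtain ⟨Q', hQ', h⟩ := Ideal.IsPrime.prod_mem_iff.mp hmem
    exact (hs Q' hQ').1 h
  · have hI : I = t.inf id := ht.inf_eq.symm
    rw [hI, Submodule.mem_finsetInf]
    intro Q' hQ't
    by_cases hQQ : Q' = Q
    · subst hQQ
      exact Ideal.mul_mem_left _ _ ha
    · have hQ' : Q' ∈ t.erase Q := Finset.mem_erase.mpr ⟨hQQ, hQ't⟩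
      rw [← Finset.mul_prod_erase _ _ hQ']
      exact Ideal.mul_mem_right _ _ (Ideal.mul_mem_right _ _ (hs Q' hQ').2)

/-- **The primary components of a homogeneous unmixed ideal are homogeneous** (Zariski–Samuel II,
Ch. VII §2, Thm. 9 and Cor.; Bruns–Herzog Lemma 1.5.6): each component `Q` is isolated, so it
coincides with its homogeneous core `Q*` — `Q*` is primary with `√Q* ⊆ √Q`, contains the
homogeneous ideal `I`, and `s a ∈ I ⊆ Q*` with `s ∉ √Q` forces `a ∈ Q*`. [folklore] -/
theorem isHomogeneous_of_mem_isMinimalPrimaryDecomposition {I : Ideal (Rx m)} {r : ℕ}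
    (hI : I.IsHomogeneous (homogeneousSubmodule (Fin (m + 1)) ℚ)) (hunm : IsUnmixedOfRank I r)
    {t : Finset (Ideal (Rx m))} (ht : Submodule.IsMinimalPrimaryDecomposition I t)
    {Q : Ideal (Rx m)} (hQ : Q ∈ t) :
    Q.IsHomogeneous (homogeneousSubmodule (Fin (m + 1)) ℚ) := by
  classical
  set Qh : Ideal (Rx m) := (Q.homogeneousCore (homogeneousSubmodule (Fin (m + 1)) ℚ)).toIdeal
    with hQh
  have hle : Qh ≤ Q := Ideal.toIdeal_homogeneousCore_le _ Q
  have hIQ : I ≤ Q := by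
    rw [← ht.inf_eq]
    exact Finset.inf_le (f := id) hQ
  have hIQh : I ≤ Qh := by
    rw [← hI.toIdeal_homogeneousCore_eq_self, hQh]
    exact Ideal.homogeneousCore_mono _ hIQ
  have hprim : Qh.IsPrimary := isPrimary_homogeneousCore (ht.primary hQ)
  suffices hQeq : Q = Qh by
    rw [hQeq, hQh]
    exact (Q.homogeneousCore (homogeneousSubmodule (Fin (m + 1)) ℚ)).isHomogeneous
  refine le_antisymm (fun a ha => ?_) hle
  obtain ⟨s, hs, hsa⟩ := exists_notMem_radical_mul_mem hunm ht hQ ha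
  rcases (Ideal.isPrimary_iff.mp hprim).2 (show a * s ∈ Qh by rw [mul_comm]; exact hIQh hsa) with
    h | h
  · exact h
  · exact absurd (Ideal.radical_mono hle h) hs

/-! ### Proposition 4.4 -/

/-- **LNM 1752, Ch. 3, Proposition 4.4** (Nesterenko): for a homogeneous unmixed ideal
`I ⊂ ℚ[x₀, …, x_m]` with `dim I = r − 1 ≥ 0`, `r ≤ m`, and reduced primary decomposition
`I = I₁ ∩ … ∩ I_s`, `𝔭_j = √I_j`, `k_j` the exponent of `I_j`: `Ī(r)` is a non-zero principal ideal
`(F)` with `F = F₁^{k₁} ⋯ F_s^{k_s}`, the `F_j` irreducible generators of the prime principal ideals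
`p̄_j(r)`, and `F` has the same degree in each block `uᵢ`. Obtained from the reduction
`NesterenkoPhilippon2001_ch3_prop_4_4_of` and the tree's proofs of its four inputs (Philippon 1986
Prop. 1.3 (ii), (iv) and Prop. 1.5; the exponent law for homogeneous primary ideals; distinct primes
have distinct associated forms), the homogeneity of the primary components being
`isHomogeneous_of_mem_isMinimalPrimaryDecomposition`.
[cite: NesterenkoPhilippon2001, Ch. 3 Prop. 4.4 (p. 38)] -/
theorem NesterenkoPhilippon2001_ch3_prop_4_4_holds : NesterenkoPhilippon2001_ch3_prop_4_4 :=
  NesterenkoPhilippon2001_ch3_prop_4_4_of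
    (fun _ r _ _ =>
      ⟨fun 𝔭 _ hp hirr => by haveI := hp; exact isPrime_elimIdeal 𝔭 r hirr,
        fun _ _ _ ht => elimIdeal_eq_iInf_of_isMinimalPrimaryDecomposition ht r⟩)
    (fun _ _ _ hr _ hhom hp hdim =>
      ⟨isPrincipal_elimIdeal_of_isPrime hp hhom hr hdim, elimIdeal_ne_bot hp hhom hr hdim⟩)
    (fun m r I hr _ hI hunm t ht Q hQ F hF => by
      classical
      have hrad : Q.radical ∈ I.associatedPrimes := by
        have h := ht.mem_associatedPrimes hQ
        rwa [Submodule.colon_univ] at h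
      have hp : Q.radical.IsPrime := Ideal.isPrime_radical (ht.primary hQ)
      have hdim : ringKrullDim (Rx m ⧸ Q.radical) = r := hunm.2 _ hrad
      have hhom : Q.radical.IsHomogeneous (homogeneousSubmodule (Fin (m + 1)) ℚ) :=
        Literature.RingTheory.GradedAlgebra.isHomogeneous_of_mem_associatedPrimes
          (homogeneousSubmodule (Fin (m + 1)) ℚ) hI hrad
      have hQhom : Q.IsHomogeneous (homogeneousSubmodule (Fin (m + 1)) ℚ) :=
        isHomogeneous_of_mem_isMinimalPrimaryDecomposition hI hunm ht hQ
      exact (elimIdeal_eq_span_pow_of_isPrimary hp hhom hr hdim (ht.primary hQ) hQhom rfl hF).symm)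
    (fun m r 𝔭 𝔭' hr hrm hhom hp hdim hhom' hp' hdim' h =>
      eq_of_elimIdeal_eq m r 𝔭 𝔭' hr hrm hhom hp hdim hhom' hp' hdim' h)

end Nesterenko

end Literature.NumberTheory.Transcendental

end
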